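import Literature.AlgebraicGeometry.Milne1999.LefschetzGroupOneProducts
import Literature.AlgebraicGeometry.Milne1999.SpecialLefschetzGroupInvariantsCMType
import HarnessLib

/-!
# Milne's Prop. 1.5 on `H¹`: `{g₁ | g ∈ ker l(X)(ℂ)}` depends only on the simple isogeny TYPES of `X` — powers drop out,
# Hom-orthogonal factors multiply (at most two isogeny types; the binary induction step)

Milne [Milne1999LefschetzClasses, Prop. 1.5 (p. 644)]: «Let `A₁, …, A_s` be a set of representatives for the simple isogeny
factors of `A`, so that there exists an isogeny `A₁^{r₁} × ⋯ × A_s^{r_s} → A` for some `rᵢ > 0`. Any such isogeny induces an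
isomorphism `S(A₁) × ⋯ × S(A_s) → S(A)`»; Cor. 4.7 (the same for `(L(A), l(A))` with the product of Def. 4.6); Thm. 4.4
(`ker l(A) = S(A)`).

The tree has the three ingredients on `H¹`, for Milne's `ker l` and `L` (all theorems):
isogeny invariance (`Milne1999/LefschetzGroupOneIsogeny`: `nonempty_map_specialLefschetzGroup_one_mulEquiv_of_isIsogeny`),
powers (`Milne1999/LefschetzGroupOnePowers`: `nonempty_map_specialLefschetzGroup_one_powSucc_mulEquiv`), Hom-orthogonal binary
products (`Milne1999/LefschetzGroupOneProducts`: `nonempty_map_specialLefschetzGroup_one_prod_mulEquiv`). This file (all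
`theorem`s, no definition, no named fact) assembles them:
* §1 `Hom(B, C) = 0 ⟹ Hom(B^{r+1}, C^{s+1}) = 0` (and for non-isogenous simple `B`, `C`);
* §2 **`X ∼ A^{r+1} ⟹ {g₁ | g ∈ ker l(X)(ℂ)} ≅ {g₁ | g ∈ ker l(A)(ℂ)}` and `L(X)(ℂ)|_{H¹} ≅ L(A)(ℂ)|_{H¹}`** (one isogeny type);
* §3 **`X ∼ B^{r+1} × C^{s+1}`, `Hom(B, C) = 0 = Hom(C, B)` ⟹ `{g₁ | g ∈ ker l(X)(ℂ)} ≅ {g₁ | g ∈ ker l(B)(ℂ)} × {g₁ | g ∈ ker l(C)(ℂ)}`**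
  — in particular for `B`, `C` simple and non-isogenous (two isogeny types: Prop. 1.5 with `s = 2`, any `r₁, r₂ > 0`).

## References

* [Milne1999LefschetzClasses] J. S. Milne, *Lefschetz classes on abelian varieties*, Duke Math. J. 96 (1999), §1 pp. 643–644,
  Prop. 1.5, Thm. 4.4, Cor. 4.7.
* [MumfordAV1970] D. Mumford, *Abelian Varieties* (1970), §19 Cor. 2 of Thm. 1 (p. 174) (homomorphisms of simple abelian varieties).
-/

noncomputable section

open CategoryTheory CategoryTheory.Limits
open Literature.AlgebraicTopology.SingularHomology
open Literature.AlgebraicGeometry.Motives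
open Literature.AlgebraicGeometry.HodgeTheory

namespace Literature.AlgebraicGeometry.Milne1999

/-! ### §1 `Hom(B^{r+1}, C^{s+1}) = 0` from `Hom(B, C) = 0` -/

section Hom

variable {B C E T : AbelianVariety ℂ}

/-- A homomorphism out of `B × C` vanishes when it vanishes on both factors (`B × C ≅ B ⊞ C`). [cite: MumfordAV1970, §19 (p. 169)] -/
theorem hom_eq_zero_of_prod_of_forall (h₁ : ∀ f : B ⟶ E, f = 0) (h₂ : ∀ g : C ⟶ E, g = 0) (u : B.prod C ⟶ E) :
    u = 0 := by
  have h : (AbelianVariety.biprodIsoProd B C).hom ≫ u = 0 :=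
    biprod.hom_ext' _ _ (by rw [comp_zero]; exact h₁ _) (by rw [comp_zero]; exact h₂ _)
  rw [← Category.id_comp u, ← (AbelianVariety.biprodIsoProd B C).inv_hom_id, Category.assoc, h, comp_zero]

/-- A homomorphism into `B × C` vanishes when both its components vanish. [cite: MumfordAV1970, §19 (p. 169)] -/
theorem hom_eq_zero_to_prod_of_forall (h₁ : ∀ f : T ⟶ B, f = 0) (h₂ : ∀ g : T ⟶ C, g = 0) (u : T ⟶ B.prod C) :
    u = 0 :=
  AbelianVariety.prod_hom_ext (by rw [h₁ (u ≫ AbelianVariety.fst B C), zero_comp])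
    (by rw [h₂ (u ≫ AbelianVariety.snd B C), zero_comp])

/-- **`Hom(B, C) = 0 ⟹ Hom(B^{r+1}, C^{s+1}) = 0`.** [cite: MumfordAV1970, §19 (p. 169)] [cite: Milne1999LefschetzClasses, §1 p. 643] -/
theorem hom_powSucc_eq_zero_of_forall_hom_eq_zero (hBC : ∀ f : B ⟶ C, f = 0) :
    ∀ (r s : ℕ) (f : B.powSucc r ⟶ C.powSucc s), f = 0
  | 0, 0 => hBC
  | 0, s + 1 => hom_eq_zero_to_prod_of_forall (hom_powSucc_eq_zero_of_forall_hom_eq_zero hBC 0 s) hBC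
  | r + 1, s => hom_eq_zero_of_prod_of_forall (hom_powSucc_eq_zero_of_forall_hom_eq_zero hBC r s)
      (hom_powSucc_eq_zero_of_forall_hom_eq_zero hBC 0 s)

/-- `Hom(S, S') = 0 = Hom(S', S)` for simple non-isogenous `S`, `S'`, hence between all their powers.
[cite: MumfordAV1970, §19 Cor. 2 of Thm. 1 (p. 174)] -/
theorem hom_powSucc_eq_zero_of_isSimple_of_not_isIsogenous (hB : AbelianVariety.IsSimple B) (hC : AbelianVariety.IsSimple C)
    (h : ¬ AbelianVariety.IsIsogenous B C) (r s : ℕ) :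
    (∀ f : B.powSucc r ⟶ C.powSucc s, f = 0) ∧ ∀ g : C.powSucc s ⟶ B.powSucc r, g = 0 :=
  ⟨hom_powSucc_eq_zero_of_forall_hom_eq_zero (hom_eq_zero_of_isSimple_of_not_isIsogenous hB hC h) r s,
    hom_powSucc_eq_zero_of_forall_hom_eq_zero
      (hom_eq_zero_of_isSimple_of_not_isIsogenous hC hB fun h' ↦ h h'.symm') s r⟩

end Hom

/-! ### §2 One isogeny type: `X ∼ A^{r+1}` -/

section OneType

variable {X : AbelianVariety ℂ} (A : AbelianVariety ℂ)

/-- **`X ∼ A^{r+1} ⟹ {g₁ | g ∈ ker l(X)(ℂ)} ≅ {g₁ | g ∈ ker l(A)(ℂ)}`** as abstract groups (`dim A ≥ 1`) — Prop. 1.5 with one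
isogeny type: «`S(A₁) → S(A)` is an isomorphism» for `A ∼ A₁^{r₁}`. [cite: Milne1999LefschetzClasses, Prop. 1.5, §1 pp. 643–644 and Thm. 4.4] -/
theorem nonempty_map_specialLefschetzGroup_one_mulEquiv_of_isIsogenous_powSucc (hA : 1 ≤ A.dim) (r : ℕ)
    (h : AbelianVariety.IsIsogenous X (A.powSucc r)) :
    Nonempty ((specialLefschetzGroup X.dim X.X).map
        (Pi.evalMonoidHom (fun k : ℕ ↦ complexBetti X.X k ≃ₗ[ℂ] complexBetti X.X k) 1) ≃*
      (specialLefschetzGroup A.dim A.X).map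
        (Pi.evalMonoidHom (fun k : ℕ ↦ complexBetti A.X k ≃ₗ[ℂ] complexBetti A.X k) 1)) := by
  obtain ⟨f, hf⟩ := h
  obtain ⟨e₁⟩ := nonempty_map_specialLefschetzGroup_one_mulEquiv_of_isIsogeny hf
  obtain ⟨e₂⟩ := nonempty_map_specialLefschetzGroup_one_powSucc_mulEquiv A hA r
  exact ⟨e₁.symm.trans e₂.symm⟩

/-- **`X ∼ A^{r+1} ⟹ L(X)(ℂ)|_{H¹} ≅ L(A)(ℂ)|_{H¹}`** as abstract groups (`dim A ≥ 1`) — Cor. 4.7 with one isogeny type.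
[cite: Milne1999LefschetzClasses, Cor. 4.7, §1 p. 643 and Thm. 4.4] -/
theorem nonempty_map_lefschetzGroup_one_mulEquiv_of_isIsogenous_powSucc (hA : 1 ≤ A.dim) (r : ℕ)
    (h : AbelianVariety.IsIsogenous X (A.powSucc r)) :
    Nonempty ((lefschetzGroup X.dim X.X).map
        (Pi.evalMonoidHom (fun k : ℕ ↦ complexBetti X.X k ≃ₗ[ℂ] complexBetti X.X k) 1) ≃*
      (lefschetzGroup A.dim A.X).map
        (Pi.evalMonoidHom (fun k : ℕ ↦ complexBetti A.X k ≃ₗ[ℂ] complexBetti A.X k) 1)) := by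
  obtain ⟨e₁⟩ := nonempty_map_lefschetzGroup_one_mulEquiv_of_isIsogenous h
  obtain ⟨e₂⟩ := nonempty_map_lefschetzGroup_one_powSucc_mulEquiv A hA r
  exact ⟨e₁.trans e₂.symm⟩

/-- `X ∼ A^{r+1}`: `MT(X)|_{H¹} = L(X)|_{H¹} ⟺ MT(A)|_{H¹} = L(A)|_{H¹}` (`dim A ≥ 1`) — «Mumford–Tate = Lefschetz on `H¹`» is read
off the isogeny type. [cite: Milne1999LefschetzClasses, §1 p. 643, §4 pp. 659–660 and Cor. 4.7] -/
theorem map_mumfordTateGroup_one_eq_map_lefschetzGroup_one_iff_of_isIsogenous_powSucc (hA : 1 ≤ A.dim) (r : ℕ)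
    (h : AbelianVariety.IsIsogenous X (A.powSucc r)) :
    (mumfordTateGroup X.dim X.X).map (Pi.evalMonoidHom (fun k : ℕ ↦ complexBetti X.X k ≃ₗ[ℂ] complexBetti X.X k) 1) =
        (lefschetzGroup X.dim X.X).map (Pi.evalMonoidHom (fun k : ℕ ↦ complexBetti X.X k ≃ₗ[ℂ] complexBetti X.X k) 1) ↔
      (mumfordTateGroup A.dim A.X).map (Pi.evalMonoidHom (fun k : ℕ ↦ complexBetti A.X k ≃ₗ[ℂ] complexBetti A.X k) 1) =
        (lefschetzGroup A.dim A.X).map (Pi.evalMonoidHom (fun k : ℕ ↦ complexBetti A.X k ≃ₗ[ℂ] complexBetti A.X k) 1) := by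
  obtain ⟨f, hf⟩ := h
  exact (map_mumfordTateGroup_one_eq_map_lefschetzGroup_one_iff_of_isIsogeny hf).trans
    (map_mumfordTateGroup_one_powSucc_eq_map_lefschetzGroup_one_iff A hA r)

end OneType

/-! ### §3 Two Hom-orthogonal isogeny types: `X ∼ B^{r+1} × C^{s+1}` -/

section TwoTypes

variable {X : AbelianVariety ℂ} (B C : AbelianVariety ℂ)

/-- **`{g₁ | g ∈ ker l(B^{r+1} × C^{s+1})(ℂ)} ≅ {g₁ | g ∈ ker l(B)(ℂ)} × {g₁ | g ∈ ker l(C)(ℂ)}`** for `Hom(B, C) = 0 = Hom(C, B)`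
(`dim B, dim C ≥ 1`): the Hom-orthogonal binary product of `Milne1999/LefschetzGroupOneProducts` for the powers (which are
again Hom-orthogonal), followed by the diagonal isomorphisms of `Milne1999/LefschetzGroupOnePowers` — Prop. 1.5 for two isogeny
types with multiplicities. [cite: Milne1999LefschetzClasses, Prop. 1.5, §1 pp. 643–644, Thm. 4.4 and Cor. 4.7] -/
theorem nonempty_map_specialLefschetzGroup_one_powSucc_prod_powSucc_mulEquiv (hBC : ∀ f : B ⟶ C, f = 0)
    (hCB : ∀ g : C ⟶ B, g = 0) (hB1 : 1 ≤ B.dim) (hC1 : 1 ≤ C.dim) (r s : ℕ) :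
    Nonempty ((specialLefschetzGroup ((B.powSucc r).prod (C.powSucc s)).dim ((B.powSucc r).prod (C.powSucc s)).X).map
        (Pi.evalMonoidHom (fun k : ℕ ↦ complexBetti ((B.powSucc r).prod (C.powSucc s)).X k ≃ₗ[ℂ]
          complexBetti ((B.powSucc r).prod (C.powSucc s)).X k) 1) ≃*
      (specialLefschetzGroup B.dim B.X).map
          (Pi.evalMonoidHom (fun k : ℕ ↦ complexBetti B.X k ≃ₗ[ℂ] complexBetti B.X k) 1) ×
        (specialLefschetzGroup C.dim C.X).map
          (Pi.evalMonoidHom (fun k : ℕ ↦ complexBetti C.X k ≃ₗ[ℂ] complexBetti C.X k) 1)) := by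
  obtain ⟨e⟩ := nonempty_map_specialLefschetzGroup_one_prod_mulEquiv (B.powSucc r) (C.powSucc s)
    (hom_powSucc_eq_zero_of_forall_hom_eq_zero hBC r s) (hom_powSucc_eq_zero_of_forall_hom_eq_zero hCB s r)
    (dim_powSucc_pos hB1 r) (dim_powSucc_pos hC1 s)
  obtain ⟨eB⟩ := nonempty_map_specialLefschetzGroup_one_powSucc_mulEquiv B hB1 r
  obtain ⟨eC⟩ := nonempty_map_specialLefschetzGroup_one_powSucc_mulEquiv C hC1 s
  exact ⟨e.trans (MulEquiv.prodCongr eB.symm eC.symm)⟩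

/-- **`X ∼ B^{r+1} × C^{s+1}`, `Hom(B, C) = 0 = Hom(C, B)` ⟹ `{g₁ | g ∈ ker l(X)(ℂ)} ≅ {g₁ | g ∈ ker l(B)(ℂ)} × {g₁ | g ∈ ker l(C)(ℂ)}`**
(`dim B, dim C ≥ 1`) — «any such isogeny induces an isomorphism `S(A₁) × S(A₂) → S(A)`».
[cite: Milne1999LefschetzClasses, Prop. 1.5, §1 pp. 643–644, Thm. 4.4 and Cor. 4.7] -/
theorem nonempty_map_specialLefschetzGroup_one_mulEquiv_prod_of_isIsogenous_powSucc_prod_powSucc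
    (hBC : ∀ f : B ⟶ C, f = 0) (hCB : ∀ g : C ⟶ B, g = 0) (hB1 : 1 ≤ B.dim) (hC1 : 1 ≤ C.dim) (r s : ℕ)
    (h : AbelianVariety.IsIsogenous X ((B.powSucc r).prod (C.powSucc s))) :
    Nonempty ((specialLefschetzGroup X.dim X.X).map
        (Pi.evalMonoidHom (fun k : ℕ ↦ complexBetti X.X k ≃ₗ[ℂ] complexBetti X.X k) 1) ≃*
      (specialLefschetzGroup B.dim B.X).map
          (Pi.evalMonoidHom (fun k : ℕ ↦ complexBetti B.X k ≃ₗ[ℂ] complexBetti B.X k) 1) ×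
        (specialLefschetzGroup C.dim C.X).map
          (Pi.evalMonoidHom (fun k : ℕ ↦ complexBetti C.X k ≃ₗ[ℂ] complexBetti C.X k) 1)) := by
  obtain ⟨f, hf⟩ := h
  obtain ⟨e₁⟩ := nonempty_map_specialLefschetzGroup_one_mulEquiv_of_isIsogeny hf
  obtain ⟨e₂⟩ := nonempty_map_specialLefschetzGroup_one_powSucc_prod_powSucc_mulEquiv B C hBC hCB hB1 hC1 r s
  exact ⟨e₁.symm.trans e₂⟩

/-- **Prop. 1.5 for two simple isogeny types**: `B`, `C` simple and non-isogenous, `X ∼ B^{r+1} × C^{s+1}` ⟹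
`{g₁ | g ∈ ker l(X)(ℂ)} ≅ {g₁ | g ∈ ker l(B)(ℂ)} × {g₁ | g ∈ ker l(C)(ℂ)}`. [cite: Milne1999LefschetzClasses, Prop. 1.5 (p. 644) and Thm. 4.4]
[cite: MumfordAV1970, §19 Cor. 2 of Thm. 1 (p. 174)] -/
theorem nonempty_map_specialLefschetzGroup_one_mulEquiv_prod_of_isSimple_of_isIsogenous_powSucc_prod_powSucc
    (hB : AbelianVariety.IsSimple B) (hC : AbelianVariety.IsSimple C) (hBC : ¬ AbelianVariety.IsIsogenous B C)
    (hB1 : 1 ≤ B.dim) (hC1 : 1 ≤ C.dim) (r s : ℕ) (h : AbelianVariety.IsIsogenous X ((B.powSucc r).prod (C.powSucc s))) :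
    Nonempty ((specialLefschetzGroup X.dim X.X).map
        (Pi.evalMonoidHom (fun k : ℕ ↦ complexBetti X.X k ≃ₗ[ℂ] complexBetti X.X k) 1) ≃*
      (specialLefschetzGroup B.dim B.X).map
          (Pi.evalMonoidHom (fun k : ℕ ↦ complexBetti B.X k ≃ₗ[ℂ] complexBetti B.X k) 1) ×
        (specialLefschetzGroup C.dim C.X).map
          (Pi.evalMonoidHom (fun k : ℕ ↦ complexBetti C.X k ≃ₗ[ℂ] complexBetti C.X k) 1)) :=
  nonempty_map_specialLefschetzGroup_one_mulEquiv_prod_of_isIsogenous_powSucc_prod_powSucc B C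
    (hom_eq_zero_of_isSimple_of_not_isIsogenous hB hC hBC)
    (hom_eq_zero_of_isSimple_of_not_isIsogenous hC hB fun h' ↦ hBC h'.symm') hB1 hC1 r s h

end TwoTypes

end Literature.AlgebraicGeometry.Milne1999

end
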